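import Mathlib.Algebra.BigOperators.Group.Finset.Basic
import Mathlib.Algebra.BigOperators.Ring.Finset
import Mathlib.Algebra.CharP.Two
import Mathlib.Algebra.Order.BigOperators.Group.Finset
import Mathlib.Data.ZMod.Basic
import Mathlib.Tactic.FinCases
import Mathlib.Tactic.IntervalCases
import Mathlib.Tactic.Linarith
import Mathlib.Tactic.Ring
import HarnessLib

/-!
# Quadratic-character parity: the algebraic skeleton of THEOREM R* (WEIL-2 gen 39, IMAGE-G39, fact-free)

research route, not a corollary; conditional on HC_CM plus one named minimal statement.

Cell `pub-hodge-ring2-ab-*` (ALL ABELIAN VARIETIES), seat WEIL-2 gen 39, account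
`run/shared/lean/pub/pub-hodge-ring2/pub-hodge-ring2-ab-weil-2/IMAGE-G39.md`.

Informal setting.  For `G = ℤ/f ⋊ ker χ_K` (`4 ∤ f`) the level character `Λ_G` (the Weil discriminant class of the
`τ`-pieces of `G`-covers, CIRCLE-G37/TWOPRIMARY-G38) is, generator by generator, a product of classes `[p]^{x_p}`,
`p | f`, whose exponents are (a) halves of degrees `[L_h : ℚ(ζ_{p^κ})]` of subfields of `ℚ(ζ_f)` and (b) `p`-adic
valuations of discriminants of real abelian fields `F ⊂ ℚ(ζ_f)`.  THEOREM R* computes the image of `Λ_G` exactly; its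
proof is parity bookkeeping resting on the following finite statements, proved here in general form:

* `natCast_sum_eq_sum_filter_fixed` — LEMMA Q (conductor–discriminant parity): if a weight `a` on a finite set is
  invariant under an involution `g` (`χ ↦ χ̄` on the character group `X(F)`, `a` = conductor exponent at `p`), then
  `∑ a ≡ ∑_{fixed points} a (mod 2)`: only the QUADRATIC characters of `F` decide `v_p(d_F) mod 2`.
* `card_filter_eval_eq_one_eq`, `even_card_filter_eval_eq_one` — LEMMA Q (b): in a set `Q` of vectors over `𝔽₂`
  stable under translation by its members (the quadratic characters of `F`, as subsets of the odd primes of `f`), the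
  members containing a given prime `p` are either none or exactly half; hence an even number as soon as `4 ∣ |Q|`
  (`dim Q ≥ 2`): then `d_F` is a square at every `p`.
* `geom_sum_mod_two` — `1 + h + ⋯ + h^{m-1} ≡ m (mod 2)` for odd `h`: the norm element `ν` of an element of even order is
  even, so `ζ_f^{aν} ≠ −1` and the prime `2` never enters (levels `f ≡ 2 (mod 4)`).
* `add_add_card_sub_two_le_sum` — the 2-adic room of THEOREM R* (i): if every `α_i ≥ 1` (`α_i = v₂(p_i − 1)`) and
  `μ ≤ α_j` for some `j ≠ p` (`μ = v₂(ord h)`), then `μ + α_p + (s − 2) ≤ ∑ α_i`; with `s ≥ 4` odd primes every exponent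
  `½ [L_h : ℚ(ζ_{p^κ})] = ½ · 2^{∑α − μ − α_p} · (odd)` is even (`even_half_of_four_dvd`).
* `orthogonal_pair_iff_cross` — the `s = 3` bookkeeping: in `𝔽₂³` the non-zero vectors orthogonal to two distinct non-zero
  vectors `a, b` are exactly `{a × b}` (the generator `u_h = 1_{P₃} × Leg(h)` of `Q(L_h⁺)`).

0 sorry, no `def`, no named fact; `HC_CM` does not occur.
-/

namespace Summit.HodgeConjecture.Ring2AbelianAll.QuadraticCharacterParity

open Finset

section involution

variable {ι : Type*} [Fintype ι] [DecidableEq ι]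

/-- **LEMMA Q (involution parity).**  For an involution `g` of a finite set and a `g`-invariant weight `a : ι → ℕ`,
the total weight is congruent mod 2 to the weight of the fixed points of `g` (the moved points pair off).
Applied to `χ ↦ χ̄` on the character group of an abelian field `F` with `a(χ) = ` the conductor exponent of `χ` at `p`:
`v_p(d_F) ≡ ∑_{χ² = 1} a_p(χ) (mod 2)` by the conductor–discriminant formula.  [locator IMAGE-G39 §1, LEMMA Q]
research route, not a corollary; conditional on HC_CM plus one named minimal statement. -/
theorem natCast_sum_eq_sum_filter_fixed (g : ι → ι) (hg : ∀ x, g (g x) = x) (a : ι → ℕ)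
    (ha : ∀ x, a (g x) = a x) :
    ((∑ x, a x : ℕ) : ZMod 2) = ((∑ x ∈ univ.filter (fun x => g x = x), a x : ℕ) : ZMod 2) := by
  classical
  have hsplit := sum_filter_add_sum_filter_not (univ : Finset ι) (fun x => g x = x) a
  have hmoved : ((∑ x ∈ univ.filter (fun x => ¬ g x = x), a x : ℕ) : ZMod 2) = 0 := by
    rw [Nat.cast_sum]
    refine Finset.sum_involution (fun x _ => g x) ?_ ?_ ?_ ?_
    · intro x hx
      rw [ha x]
      exact CharTwo.add_self_eq_zero _
    · intro x hx _
      exact (mem_filter.mp hx).2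
    · intro x hx
      refine mem_filter.mpr ⟨mem_univ _, ?_⟩
      intro h
      exact (mem_filter.mp hx).2 (h.symm.trans (hg x))
    · intro x hx
      exact hg x
  rw [← hsplit, Nat.cast_add, hmoved, add_zero]

/-- The `ℕ`-form of `natCast_sum_eq_sum_filter_fixed`: `∑ a ≡ ∑_{fixed} a (mod 2)`.  [locator IMAGE-G39 §1, LEMMA Q]
research route, not a corollary; conditional on HC_CM plus one named minimal statement. -/
theorem sum_mod_two_eq_sum_filter_fixed_mod_two (g : ι → ι) (hg : ∀ x, g (g x) = x) (a : ι → ℕ)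
    (ha : ∀ x, a (g x) = a x) :
    (∑ x, a x) % 2 = (∑ x ∈ univ.filter (fun x => g x = x), a x) % 2 :=
  (ZMod.natCast_eq_natCast_iff' _ _ 2).mp (natCast_sum_eq_sum_filter_fixed g hg a ha)

end involution

section translation

variable {ι : Type*}

/-- In `ι → ZMod 2` every vector is `2`-torsion: `U + U = 0`.
research route, not a corollary; conditional on HC_CM plus one named minimal statement. -/
theorem add_self_eq_zero_pi (U : ι → ZMod 2) : U + U = 0 := by
  funext i
  exact CharTwo.add_self_eq_zero (U i)

/-- **LEMMA Q (b), translation.**  Let `Q` be a finite set of vectors over `𝔽₂` stable under translation by a member `U₀`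
with `U₀ p = 1`.  Then translation by `U₀` is a bijection between the members with `p`-coordinate `1` and those with
`p`-coordinate `0`; in particular exactly half of `Q` contains `p`.  (For `Q = ` the quadratic characters of a subfield
`F ⊂ ℚ(ζ_f)`, as subsets of the odd primes of `f`: `v_p(d_F) ≡ |Q|/2` or `0`.)  [locator IMAGE-G39 §1, LEMMA Q (b)]
research route, not a corollary; conditional on HC_CM plus one named minimal statement. -/
theorem card_filter_eval_eq_one_eq (Q : Finset (ι → ZMod 2)) (U₀ : ι → ZMod 2)
    (hQ : ∀ U ∈ Q, U + U₀ ∈ Q) (p : ι) (hp : U₀ p = 1) :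
    (Q.filter (fun U => U p = 1)).card = (Q.filter (fun U => U p = 0)).card := by
  refine Finset.card_bij' (fun U _ => U + U₀) (fun V _ => V + U₀) ?_ ?_ ?_ ?_
  · intro U hU
    obtain ⟨hUQ, hU1⟩ := mem_filter.mp hU
    refine mem_filter.mpr ⟨hQ U hUQ, ?_⟩
    show U p + U₀ p = 0
    rw [hU1, hp]; decide
  · intro V hV
    obtain ⟨hVQ, hV0⟩ := mem_filter.mp hV
    refine mem_filter.mpr ⟨hQ V hVQ, ?_⟩
    show V p + U₀ p = 1
    rw [hV0, hp]; decide
  · intro U hU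
    rw [add_assoc, add_self_eq_zero_pi, add_zero]
  · intro V hV
    rw [add_assoc, add_self_eq_zero_pi, add_zero]

/-- **LEMMA Q (b), parity.**  If `Q` (as above) is stable under translation by each of its members and `4 ∣ |Q|`
(i.e. `dim Q ≥ 2` for a subspace), then for every coordinate `p` the number of members with `U p = 1` is EVEN.
Consequence: a real abelian field `F ⊂ ℚ(ζ_f)` (`4 ∤ f`) with at least three quadratic subfields... more precisely with
`|X(F)[2]| ≥ 4`, has `d_F ≡ 1` modulo squares.  [locator IMAGE-G39 §1, LEMMA Q (b)]
research route, not a corollary; conditional on HC_CM plus one named minimal statement. -/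
theorem even_card_filter_eval_eq_one (Q : Finset (ι → ZMod 2)) (hQ : ∀ U ∈ Q, ∀ U₀ ∈ Q, U + U₀ ∈ Q)
    (h4 : 4 ∣ Q.card) (p : ι) : Even (Q.filter (fun U => U p = 1)).card := by
  by_cases hex : ∃ U₀ ∈ Q, U₀ p = 1
  · obtain ⟨U₀, hU₀Q, hU₀p⟩ := hex
    have hbij := card_filter_eval_eq_one_eq Q U₀ (fun U hU => hQ U hU U₀ hU₀Q) p hU₀p
    have hsum := Finset.card_filter_add_card_filter_not (s := Q) (fun U => U p = 1)
    have hneg : (Q.filter (fun U => ¬ U p = 1)).card = (Q.filter (fun U => U p = 0)).card := by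
      congr 1
      apply Finset.filter_congr
      intro U _
      constructor
      · intro h
        have : ∀ z : ZMod 2, ¬ z = 1 → z = 0 := by decide
        exact this _ h
      · intro h
        rw [h]; decide
    rw [hneg, ← hbij] at hsum
    obtain ⟨k, hk⟩ := h4
    refine ⟨k, ?_⟩
    omega
  · have hempty : Q.filter (fun U => U p = 1) = ∅ := by
      apply Finset.filter_eq_empty_iff.mpr
      intro U hU h
      exact hex ⟨U, hU, h⟩
    rw [hempty, card_empty]
    exact ⟨0, rfl⟩

end translation

section geomsum

/-- **The norm element of an odd residue is congruent to the order mod 2.**  For odd `h`,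
`1 + h + ⋯ + h^{m−1} ≡ m (mod 2)`.  Used with `h ∈ (ℤ/f)^×` (`f ≡ 2 (mod 4)`, so `h` odd) of even order `m`:
`ν = ∑_{t<m} h^t` is even, hence `ζ_f^{aν}` never equals `−1` and the prime `2` never enters the level character.
[locator IMAGE-G39 §2 (E6)]  research route, not a corollary; conditional on HC_CM plus one named minimal statement. -/
theorem geom_sum_mod_two (h m : ℕ) (hh : Odd h) : (∑ t ∈ range m, h ^ t) % 2 = m % 2 := by
  induction m with
  | zero => simp
  | succ m ih =>
    rw [sum_range_succ, Nat.add_mod, ih]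
    have hpow : h ^ m % 2 = 1 := Nat.odd_iff.mp (hh.pow)
    rw [hpow]
    omega

end geomsum

section room

variable {ι : Type*} [DecidableEq ι]

/-- **The 2-adic room.**  If `α_i ≥ 1` for all `i ∈ s`, `p ≠ j` both lie in `s` and `μ ≤ α_j`, then
`μ + α_p + (|s| − 2) ≤ ∑_{i∈s} α_i`.  (With `α_i = v₂(p_i − 1)` over the odd primes of `f`, `μ = v₂(ord h) ≤ α_j` for a
prime `j ≠ p` at which `h` has even order, this is `v₂[L_h : ℚ(ζ_{p^κ})] = ∑α − μ − α_p ≥ s − 2`.)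
[locator IMAGE-G39 §2 (E2)–(E4), §3]  research route, not a corollary; conditional on HC_CM plus one named minimal statement. -/
theorem add_add_card_sub_two_le_sum (s : Finset ι) (α : ι → ℕ) (hα : ∀ i ∈ s, 1 ≤ α i) (p j : ι)
    (hp : p ∈ s) (hj : j ∈ s) (hpj : p ≠ j) (μ : ℕ) (hμ : μ ≤ α j) :
    μ + α p + (s.card - 2) ≤ ∑ i ∈ s, α i := by
  have hj' : j ∈ s.erase p := Finset.mem_erase.mpr ⟨hpj.symm, hj⟩
  have h1 : ∑ i ∈ s, α i = α p + ∑ i ∈ s.erase p, α i := (Finset.add_sum_erase s α hp).symm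
  have h2 : ∑ i ∈ s.erase p, α i = α j + ∑ i ∈ (s.erase p).erase j, α i :=
    (Finset.add_sum_erase _ α hj').symm
  have hcard : ((s.erase p).erase j).card = s.card - 2 := by
    rw [Finset.card_erase_of_mem hj', Finset.card_erase_of_mem hp]
    omega
  have h3 : ((s.erase p).erase j).card • 1 ≤ ∑ i ∈ (s.erase p).erase j, α i :=
    Finset.card_nsmul_le_sum _ _ 1 (fun i hi => hα i (Finset.mem_of_mem_erase (Finset.mem_of_mem_erase hi)))
  rw [smul_eq_mul, mul_one, hcard] at h3
  omega

/-- **THEOREM R* (i), the parity step.**  With at least four indices (`s ≥ 4` odd primes) the room is `≥ 2`: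
`μ + α_p + 2 ≤ ∑ α_i`, so `∑α − μ − α_p ≥ 2` and `2^{∑α − μ − α_p} · n / 2` is even for every `n`.
[locator IMAGE-G39 §3]  research route, not a corollary; conditional on HC_CM plus one named minimal statement. -/
theorem add_add_two_le_sum_of_four_le_card (s : Finset ι) (α : ι → ℕ) (hα : ∀ i ∈ s, 1 ≤ α i) (p j : ι)
    (hp : p ∈ s) (hj : j ∈ s) (hpj : p ≠ j) (μ : ℕ) (hμ : μ ≤ α j) (h4 : 4 ≤ s.card) :
    μ + α p + 2 ≤ ∑ i ∈ s, α i := by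
  have := add_add_card_sub_two_le_sum s α hα p j hp hj hpj μ hμ
  omega

/-- `2^E · n / 2` is even as soon as `E ≥ 2` (the exponent `½ [L_h : ℚ(ζ_{p^κ})]` in THEOREM R* (i)).
[locator IMAGE-G39 §3]  research route, not a corollary; conditional on HC_CM plus one named minimal statement. -/
theorem even_two_pow_mul_div_two (E n : ℕ) (hE : 2 ≤ E) : Even (2 ^ E * n / 2) := by
  obtain ⟨k, rfl⟩ := Nat.exists_eq_add_of_le hE
  refine ⟨2 ^ k * n, ?_⟩
  rw [pow_add, show (2 : ℕ) ^ 2 = 2 * 2 by norm_num, mul_assoc, mul_assoc, Nat.mul_div_cancel_left _ (by norm_num)]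
  ring

/-- **THEOREM R* (i) in one line.**  With `s ≥ 4` odd primes, every exponent `½ [L_h : ℚ(ζ_{p^κ})] =
(2^{∑α − μ − α_p} · n)/2` (`n` odd or not) occurring in the closed form of the level character is EVEN — the cyclotomic-unit
norms `N_{L_h/ℚ}(1 − ζ^{aν}) = p^{[L_h : ℚ(ζ_{p^κ})]}` contribute squares only.  [locator IMAGE-G39 §3]
research route, not a corollary; conditional on HC_CM plus one named minimal statement. -/
theorem even_half_degree_of_four_le_card (s : Finset ι) (α : ι → ℕ) (hα : ∀ i ∈ s, 1 ≤ α i) (p j : ι)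
    (hp : p ∈ s) (hj : j ∈ s) (hpj : p ≠ j) (μ : ℕ) (hμ : μ ≤ α j) (h4 : 4 ≤ s.card) (n : ℕ) :
    Even (2 ^ (∑ i ∈ s, α i - μ - α p) * n / 2) := by
  have h := add_add_two_le_sum_of_four_le_card s α hα p j hp hj hpj μ hμ h4
  exact even_two_pow_mul_div_two _ n (by omega)

end room

section cross

/-- **The `s = 3` bookkeeping (cross product in `𝔽₂³`).**  For two distinct non-zero vectors `a, b ∈ 𝔽₂³` the vectors
`u` orthogonal to both are exactly `0` and the cross product `a × b` (which is non-zero): the quadratic characters of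
`L_h⁺` are `⟨1_{P₃}, Leg(h)⟩^⊥ = {0, 1_{P₃} × Leg(h)}` when `1_{P₃}` and `Leg(h)` are independent, so
`u_h = 1_{P₃} × Leg(h)`.  Proved by exhausting the `2⁹` cases.  [locator IMAGE-G39 §4]
research route, not a corollary; conditional on HC_CM plus one named minimal statement. -/
theorem orthogonal_pair_iff_cross :
    ∀ a₀ a₁ a₂ b₀ b₁ b₂ u₀ u₁ u₂ : ZMod 2,
      ¬ (a₀ = 0 ∧ a₁ = 0 ∧ a₂ = 0) → ¬ (b₀ = 0 ∧ b₁ = 0 ∧ b₂ = 0) → ¬ (a₀ = b₀ ∧ a₁ = b₁ ∧ a₂ = b₂) →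
      ((a₀ * u₀ + a₁ * u₁ + a₂ * u₂ = 0 ∧ b₀ * u₀ + b₁ * u₁ + b₂ * u₂ = 0) ↔
        ((u₀ = 0 ∧ u₁ = 0 ∧ u₂ = 0) ∨
         (u₀ = a₁ * b₂ + a₂ * b₁ ∧ u₁ = a₂ * b₀ + a₀ * b₂ ∧ u₂ = a₀ * b₁ + a₁ * b₀))) := by
  decide

/-- The cross product of two distinct non-zero vectors of `𝔽₂³` is non-zero (so `dim Q(L_h⁺) = 1` exactly and
`[d_{L_h⁺}] = [n_{u_h}] ≠ 1` formally).  [locator IMAGE-G39 §4]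
research route, not a corollary; conditional on HC_CM plus one named minimal statement. -/
theorem cross_ne_zero :
    ∀ a₀ a₁ a₂ b₀ b₁ b₂ : ZMod 2,
      ¬ (a₀ = 0 ∧ a₁ = 0 ∧ a₂ = 0) → ¬ (b₀ = 0 ∧ b₁ = 0 ∧ b₂ = 0) → ¬ (a₀ = b₀ ∧ a₁ = b₁ ∧ a₂ = b₂) →
      ¬ (a₁ * b₂ + a₂ * b₁ = 0 ∧ a₂ * b₀ + a₀ * b₂ = 0 ∧ a₀ * b₁ + a₁ * b₀ = 0) := by
  decide

end cross

end Summit.HodgeConjecture.Ring2AbelianAll.QuadraticCharacterParity
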